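import Summits.AtomisticToContinuum.Crystallization.Theorems.PalmUnimodularRigidityLayeredLawsSelectHcpCertificateDefs
import Mathlib.MeasureTheory.Integral.Bochner.SumMeasure
import Mathlib.MeasureTheory.Measure.Count
import Mathlib.Algebra.BigOperators.Finprod

/-!
# Crux `LayeredLawsSelectHcp` (stmt-AtomisticToContinuum-9226), line `mtp-prestress-split-ergodic-frame`:
# Bochner integrals against a counting measure `count|S` of finitely supported functions are finite sums

Registered sub-goal `tube_integral_count_restrict_of_finite_support` of the crux item (lead c2 reshape; certificate
calculus).  Samples of the point-process laws of the crux are a.s. counting measures `count|S` (`S ⊆ ℝ³` locally finite,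
typically infinite, in an uncountable ambient space); the Mecke transport functions of the corrector calculus are supported
on finitely many atoms, and their integrals against `count|S` must be evaluated as finite sums:
`∫ f d(count|S) = ∑ᶠ y ∈ S, f y` whenever `S ∩ support f` is finite.  Proof: `f` is its own indicator on its (measurable)
support `T`, so `∫ f d(count|S) = ∫_T f d(count|S) = ∫ f d(count|(T ∩ S))`; `T ∩ S` is a finite set `F`, `f` is integrable
on it (a finite union of singletons of count-mass one), and `MeasureTheory.setIntegral_finset` evaluates the integral as
`∑ y ∈ F, f y = ∑ᶠ y ∈ S, f y` (`finsum_mem_eq_sum`). [folklore]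
-/

noncomputable section

namespace Summit.AtomisticToContinuum.Crystallization.Theorems.PalmUnimodularRigidity.LayeredLawsSelectHcp

open MeasureTheory Set

/-- A measurable real function is integrable against the counting measure on any finite set. [folklore] -/
theorem integrableOn_count_of_finite {S : Set (EuclideanSpace ℝ (Fin 3))} (hS : S.Finite)
    (f : EuclideanSpace ℝ (Fin 3) → ℝ) :
    IntegrableOn f S (Measure.count : Measure (EuclideanSpace ℝ (Fin 3))) := by
  rw [← S.biUnion_of_singleton, integrableOn_finite_biUnion hS]
  intro y _
  exact integrableOn_singleton (hx := by simp)

/-- **Integrals against a counting measure of finitely supported functions** (registered sub-goal of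
stmt-AtomisticToContinuum-9226): if `S ∩ support f` is finite then `∫ f d(count|S) = ∑ᶠ y ∈ S, f y`. [folklore] -/
theorem tube_integral_count_restrict_of_finite_support : ∀ (S : Set (EuclideanSpace ℝ (Fin 3))) (f : EuclideanSpace ℝ (Fin 3) → ℝ), Measurable f → (S ∩ Function.support f).Finite → ∫ y, f y ∂((MeasureTheory.Measure.count : MeasureTheory.Measure (EuclideanSpace ℝ (Fin 3))).restrict S) = ∑ᶠ y ∈ S, f y := by
  intro S f hf hfin
  have hT : MeasurableSet (Function.support f) := measurableSet_support hf
  calc ∫ y, f y ∂((Measure.count : Measure (EuclideanSpace ℝ (Fin 3))).restrict S)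
      = ∫ y in Function.support f, f y ∂((Measure.count : Measure (EuclideanSpace ℝ (Fin 3))).restrict S) := by
        rw [← integral_indicator hT, indicator_eq_self.2 Subset.rfl]
    _ = ∫ y in (↑hfin.toFinset : Set (EuclideanSpace ℝ (Fin 3))), f y ∂(Measure.count : Measure (EuclideanSpace ℝ (Fin 3))) := by
        rw [Measure.restrict_restrict hT, hfin.coe_toFinset, inter_comm]
    _ = ∑ y ∈ hfin.toFinset, f y := by
        rw [setIntegral_finset _ (by rw [hfin.coe_toFinset]; exact integrableOn_count_of_finite hfin f)]
        simp only [count_real_singleton, one_smul]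
    _ = ∑ᶠ y ∈ S, f y := (finsum_mem_eq_sum f hfin).symm

end Summit.AtomisticToContinuum.Crystallization.Theorems.PalmUnimodularRigidity.LayeredLawsSelectHcp

end
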